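import Summits.HodgeConjecture.HodgeConjecture.Theorems.R90S3CompletionOfDenseEmbedding   -- ★ P1 p863617 (this seat): `exists_adicCompletion_ringEquiv_of_denseRange`
import Summits.HodgeConjecture.HodgeConjecture.Theorems.R90S3LocalRingIsoOfPlaceIso        -- ★ F-c shell p863290: `exists_localRing_equiv_of_adicCompletion_equiv`
import Literature.NumberTheory.Automorphic.GaloisActionPlaces                               -- ★ `galAdicCompletionMap`, `valued_galAdicCompletionMap`, `galAdicCompletionMap_coe_algEquiv`
import Literature.NumberTheory.Automorphic.UnitaryGroupNonsplitPlace                        -- ★ `PlacesOver.subsingleton_of_smul_eq`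
import HarnessLib

/-!
# R90-TF · S3, (U3-F) brick P8a: THE LOCAL HALF OF THE AUXILIARY GLOBALISATION — a dense, conjugation-equivariant embedding `J : L′ → L_w` of a CM field
# yields the socket's place `v′` and its bicontinuous conjugation-intertwining `Φ : L ⊗_{L⁺} L⁺_v ≃+* L′ ⊗_{L′⁺} L′⁺_{v′}`
# (`Theorems/R90S3PlantedLocalIso.lean`; dealer R90-C12-plan (g2) 00:44:33Z «P8a … the LOCAL HALF of the assembly, no planting inside», cut confirmed by the 00:46Z census)

Cell `hodgecm-mathlib`, crux H413 (`stmt-HodgeConjecture-24833`), route of record `HCCMUnconditional`; programme R90-TF, section S3 (base `R90-C12`), the (U3-F)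
residual `stub_R90_S3_auxGlobaliseField` of `Cruxes/H413/Lines/R90_S3_LocalTransportWaveG.lean` (ED. 3 :654–:669).  Lane `--supports stmt-HodgeConjecture-24833
--as helper`; THEOREMS ONLY; ★-only imports (a `Theorems/` file never imports `Cruxes/…/Lines`); ns `…R90.S3`.

THE MATHEMATICS [Rogawski1990 §13.8 p. 216 «we can choose `E∕F` and `w` such that `E_w∕F_w` is isomorphic to `E′∕F′`»; Cassels–Fröhlich II §10, VII §1.1].
INPUT: the CM field `L`, a finite place `v` of `L⁺` and a place `w ∣ v` fixed by complex conjugation (non-split), a CM field `L′`, and a ring homomorphism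
`J : L′ →+* L_w` with DENSE image intertwining the complex conjugations (`J ∘ c′ = σ_w ∘ J`, `σ_w` the tree's `galAdicCompletionMap c hw` on `L_w`) — in P8 this `J`
is the planted embedding `α ↦ β`, `√γ ↦ s·δ` (P8b).  OUTPUT (`exists_localRing_equiv_of_denseRange_equivariant`): the place `w′` of `L′` of `J` (★ P1:
`x ∈ w′ ⟺ v(J x) < 1`), `v′ := w′ ∩ L′⁺`, the socket's `Φ` with its three clauses `Continuous Φ`, `Continuous Φ.symm`, `Φ ∘ (c ⊗ 1) = (c′ ⊗ 1) ∘ Φ` VERBATIM,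
the socket's non-split clause `∀ w″ ∣ v′, c′ • w″ = w″` VERBATIM, and the value clause `(Φ y)_{w′} = ψ (y_w)` for the bicontinuous `ψ : L_w ≃+* L′_{w′}` with
`ψ (J x) = x`.  Steps: §1 the place of an equivariant dense embedding is conjugation-fixed (`v(J(c′⁻¹ y)) = v(σ_w⁻¹… ) = v(J y)`, ★ `valued_galAdicCompletionMap`); §2
`ψ := (P1-isomorphism)⁻¹` intertwines `σ_w` and `σ′_{w′}` (two continuous maps agreeing on the dense `J(L′)`, ★ `galAdicCompletionMap_coe_algEquiv`); §3 HEAD via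
the ★ F-c shell `exists_localRing_equiv_of_adicCompletion_equiv` and ★ `PlacesOver.subsingleton_of_smul_eq`.
HONEST LABEL: P8a is a sub-brick of the GENUINE residual (U3-F) and closes nothing alone (the global clauses ⟪U⟫ and `3 ≤ [L′⁺:ℚ]` and the construction of `J`
are P5∕P6∕P9′∕P7∕P3∕P8b); HC_CM is proved only modulo the 7 printed citations (2 remaining named inputs: hLiu418 = stmt-HodgeConjecture-24832,
h413 = stmt-HodgeConjecture-24833) until rung 0 closes; count-neutral helper.

## References
* [Rogawski1990] J. D. Rogawski, *Automorphic Representations of Unitary Groups in Three Variables*, Ann. of Math. Stud. 123 (1990), §13.8 pp. 212, 216.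
* [CasselsFrohlichANT1967] J. W. S. Cassels, A. Fröhlich (eds.), *Algebraic Number Theory* (1967), Ch. II §10; Ch. VII §1.1, Prop. 1.2 (ii).
-/

set_option autoImplicit false
-- the mandated namespace repeats the single-problem summit's segment (`HodgeConjecture.HodgeConjecture`)
set_option linter.dupNamespace false

noncomputable section

open IsDedekindDomain NumberField Topology
open Literature.NumberTheory.Automorphic Literature.NumberTheory.Automorphic.UnitaryGroup

namespace Summit.HodgeConjecture.HodgeConjecture.R90.S3

variable (L : Type) [Field L] [NumberField L] [IsCMField L] (v : HeightOneSpectrum (𝓞 ↥(maximalRealSubfield L)))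
  (w : PlacesOver L v) (hw : IsCMField.complexConj L • w.1 = w.1)
  (L' : Type) [Field L'] [NumberField L'] [IsCMField L']
  (J : L' →+* w.1.adicCompletion L)
  (hJσ : ∀ x : L', J (IsCMField.complexConj L' x) = galAdicCompletionMap (L := L) (IsCMField.complexConj L) hw (J x))

/-! ## §1 The place of an equivariant dense embedding is fixed by complex conjugation -/

include hJσ in
/-- `v(J(c′ x)) = v(J x)`: the embedding composed with `c′` has the same valuation (`J ∘ c′ = σ_w ∘ J` and ★ `valued_galAdicCompletionMap`).
[cite: CasselsFrohlichANT1967, Ch. VII §1.1] -/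
theorem valued_apply_complexConj (x : L') : Valued.v (J (IsCMField.complexConj L' x)) = Valued.v (J x) := by
  rw [hJσ, valued_galAdicCompletionMap]

include hJσ in
/-- **The place `w′` of `L′` cut out by `J` (`x ∈ w′ ⟺ v(J x) < 1`, ★ P1) is fixed by the complex conjugation of `L′`.** [cite: CasselsFrohlichANT1967, Ch. VII §1.1] -/
theorem complexConj_smul_eq_of_place {w' : HeightOneSpectrum (𝓞 L')} (hw' : ∀ x : 𝓞 L', x ∈ w'.asIdeal ↔ Valued.v (J (x : L')) < 1) :
    IsCMField.complexConj L' • w' = w' := by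
  refine HeightOneSpectrum.ext (Ideal.ext fun y => ?_)
  rw [HeightOneSpectrum.smul_asIdeal, Ideal.mem_pointwise_smul_iff_inv_smul_mem, hw', hw',
    Literature.NumberTheory.Automorphic.RingOfIntegers.coe_algEquiv_smul, AlgEquiv.aut_inv]
  conv_rhs => rw [← (IsCMField.complexConj L').apply_symm_apply (y : L'), valued_apply_complexConj L v w hw L' J hJσ]

/-! ## §2 The inverse of P1's isomorphism intertwines the conjugations -/

include hJσ in
/-- **`ψ ∘ σ_w = σ′_{w′} ∘ ψ` for `ψ := (P1-isomorphism)⁻¹ : L_w ≃+* L′_{w′}`** — both sides are continuous and agree on the dense image `J(L′)`, where they are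
`J x ↦ (c′ x : L′_{w′})` (`ψ (J x) = x`, `J (c′ x) = σ_w (J x)`, ★ `galAdicCompletionMap_coe_algEquiv`). [cite: CasselsFrohlichANT1967, Ch. VII §1.1] -/
theorem symm_galAdicCompletionMap_eq (hJ : DenseRange J) {w' : HeightOneSpectrum (𝓞 L')} (hw' : IsCMField.complexConj L' • w' = w')
    (ψ : w'.adicCompletion L' ≃+* w.1.adicCompletion L) (hψ' : Continuous ψ.symm) (hψJ : ∀ x : L', ψ (x : w'.adicCompletion L') = J x)
    (y : w.1.adicCompletion L) :
    ψ.symm (galAdicCompletionMap (L := L) (IsCMField.complexConj L) hw y) = galAdicCompletionMap (L := L') (IsCMField.complexConj L') hw' (ψ.symm y) := by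
  have h1 : Continuous fun y => ψ.symm (galAdicCompletionMap (L := L) (IsCMField.complexConj L) hw y) :=
    hψ'.comp (continuous_galAdicCompletionMap L (IsCMField.complexConj L) hw)
  have h2 : Continuous fun y => galAdicCompletionMap (L := L') (IsCMField.complexConj L') hw' (ψ.symm y) :=
    (continuous_galAdicCompletionMap L' (IsCMField.complexConj L') hw').comp hψ'
  have h3 : (fun y => ψ.symm (galAdicCompletionMap (L := L) (IsCMField.complexConj L) hw y)) ∘ J =
      (fun y => galAdicCompletionMap (L := L') (IsCMField.complexConj L') hw' (ψ.symm y)) ∘ J := by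
    funext x
    simp only [Function.comp_apply]
    rw [← hJσ, ← hψJ, ← hψJ, RingEquiv.symm_apply_apply, RingEquiv.symm_apply_apply, galAdicCompletionMap_coe_algEquiv]
  exact congr_fun (hJ.equalizer h1 h2 h3) y

/-! ## §3 HEAD: the socket's `(v′, Φ)` with its clauses, from the dense equivariant embedding -/

include hJσ in
/-- **P8a — THE LOCAL HALF OF (U3-F).**  For a CM field `L`, a finite place `v` of `L⁺` with a conjugation-fixed place `w ∣ v`, a CM field `L′` and a ring homomorphism
`J : L′ →+* L_w` with dense image and `J ∘ c′ = σ_w ∘ J`: there are a finite place `v′` of `L′⁺`, a place `w′ ∣ v′` — THE place of `J`, `x ∈ w′ ⟺ v(J x) < 1` — a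
bicontinuous `ψ : L_w ≃+* L′_{w′}` with `ψ (J x) = x`, and a ring isomorphism `Φ : L ⊗_{L⁺} L⁺_v ≃+* L′ ⊗_{L′⁺} L′⁺_{v′}` with the (U3-F) socket's clauses VERBATIM —
`Continuous Φ`, `Continuous Φ.symm`, `Φ ∘ (c ⊗ 1) = (c′ ⊗ 1) ∘ Φ`, `∀ w″ ∣ v′, c′ • w″ = w″` — and the value clause `(Φ y)_{w′} = ψ (y_w)`.  Proof: ★ P1 on `J`; §1; §2;
★ F-c shell; ★ `PlacesOver.subsingleton_of_smul_eq`. [cite: Rogawski1990, §13.8 p. 216] [cite: CasselsFrohlichANT1967, Ch. II §10; Ch. VII Prop. 1.2 (ii)] -/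
theorem exists_localRing_equiv_of_denseRange_equivariant (hJ : DenseRange J) :
    ∃ (v' : HeightOneSpectrum (𝓞 ↥(maximalRealSubfield L'))) (w' : PlacesOver L' v')
      (ψ : w.1.adicCompletion L ≃+* w'.1.adicCompletion L') (Φ : UnitaryGroup.LocalRing L v ≃+* UnitaryGroup.LocalRing L' v'),
      (∀ x : 𝓞 L', x ∈ w'.1.asIdeal ↔ Valued.v (J (x : L')) < 1) ∧
      Continuous ψ ∧ Continuous ψ.symm ∧ (∀ x : L', ψ (J x) = (x : w'.1.adicCompletion L')) ∧
      Continuous Φ ∧ Continuous Φ.symm ∧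
      (∀ x, Φ ((conjLocal L (IsCMField.complexConj L) v) x) = (conjLocal L' (IsCMField.complexConj L') v') (Φ x)) ∧
      (∀ w'' : PlacesOver L' v', IsCMField.complexConj L' • w''.1 = w''.1) ∧
      (∀ y, Φ y w' = ψ (y w)) := by
  haveI : Algebra.IsQuadraticExtension ↥(maximalRealSubfield L') L' := IsCMField.isQuadraticExtension L'
  -- P1: the place and the isomorphism of `J`
  obtain ⟨w', hw'mem, ψ₀, hψ₀, hψ₀', hψ₀J⟩ := exists_adicCompletion_ringEquiv_of_denseRange w.1 J hJ
  have hw' : IsCMField.complexConj L' • w' = w' := complexConj_smul_eq_of_place L v w hw L' J hJσ hw'mem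
  let v' : HeightOneSpectrum (𝓞 ↥(maximalRealSubfield L')) := w'.under (𝓞 ↥(maximalRealSubfield L'))
  let w'P : PlacesOver L' v' := ⟨w', rfl⟩
  have hw'P : IsCMField.complexConj L' • w'P.1 = w'P.1 := hw'
  haveI := PlacesOver.subsingleton_of_smul_eq (IsCMField.complexConj L') (IsCMField.complexConj_ne_one L') w'P hw'P
  -- `ψ := ψ₀⁻¹` intertwines the conjugations
  have hψσ : ∀ y, ψ₀.symm (galAdicCompletionMap (L := L) (IsCMField.complexConj L) hw y) =
      galAdicCompletionMap (L := L') (IsCMField.complexConj L') hw'P (ψ₀.symm y) :=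
    symm_galAdicCompletionMap_eq L v w hw L' J hJσ hJ hw'P ψ₀ hψ₀' hψ₀J
  -- the F-c shell
  obtain ⟨Φ, hΦc, hΦc', hΦσ, hΦval⟩ := exists_localRing_equiv_of_adicCompletion_equiv L v L' v' w hw w'P hw'P ψ₀.symm hψ₀' (by simpa using hψ₀) hψσ
  refine ⟨v', w'P, ψ₀.symm, Φ, hw'mem, hψ₀', by simpa using hψ₀, fun x => ?_, hΦc, hΦc', hΦσ, fun w'' => ?_, hΦval⟩
  · rw [RingEquiv.symm_apply_eq, hψ₀J]
  · rw [Subsingleton.elim w'' w'P]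
    exact hw'P

omit [IsCMField L] [NumberField L'] [IsCMField L'] in
/-- **The place `v′` below, read on `L′⁺`**: under the hypotheses of the head, with `w′` the place of `J` and `v′ = w′ ∩ 𝓞_{L′⁺}`, an integer `x ∈ 𝓞_{L′⁺}` lies in `v′`
iff `v(J x) < 1` — the form P5∕P6∕P9′ read (`(α) = 𝔭_{v′}^k`, unit tests away from `v′`). [cite: CasselsFrohlichANT1967, Ch. II §10] -/
theorem mem_under_iff_valued_apply_lt_one {w' : HeightOneSpectrum (𝓞 L')} (hw' : ∀ x : 𝓞 L', x ∈ w'.asIdeal ↔ Valued.v (J (x : L')) < 1)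
    (x : 𝓞 ↥(maximalRealSubfield L')) :
    x ∈ (w'.under (𝓞 ↥(maximalRealSubfield L'))).asIdeal ↔ Valued.v (J (algebraMap ↥(maximalRealSubfield L') L' x)) < 1 := by
  rw [HeightOneSpectrum.under_asIdeal, Ideal.under_def, Ideal.mem_comap, hw']
  rfl

end Summit.HodgeConjecture.HodgeConjecture.R90.S3

end
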